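/-
COR-CM (cell pub-hodgecm2, stage 2 of the Hodge ladder) — count-neutral KERNEL COMBINATORICS «field level of the SYLOW TRANSFER, VIII: every Galois CM
field of degree 8m (m odd, 3 ∤ m) is an odd-degree Galois extension of a Galois octic subfield» (seat prover-pub-hodgecm2-b23-g57-0, binder prover b23,
gen 57; own census lane SYLOW TRANSFER, blanket `CorCM/FaceSylowTransfer*` HOME/INBOX.md l.23357, claim l.26753).  Theorems only; pure Galois theory on
`Census/SylowTransferTwoNilpotent.lean` (this seat) and gen 33ʼs `FaceCensusGroupDictionary` (the conjugation automorphism) BY NAME; nothing asserted, no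
period, no face count.  `Interfaces.lean` (C1), every E term, B01, `Transposition/*`, `PortJoin/*`, `D2Bridge/*` untouched.
HONEST FRAMING: `HC_CM` is NOT proved, here or anywhere in the tree.
T5: n/a-class (hypothesis binders: `[F:ℚ] = 8m`, `m` odd, `3 ∤ m` — inhabited by every Galois CM field of degree 40, 56, 88, 104, …; checker: self, 2026-08-26).
-/
import Summits.HodgeConjecture.CorCM.Census.SylowTransferTwoNilpotent
import Summits.HodgeConjecture.CorCM.FaceSylowTransferReflected
import HarnessLib

/-!
# Field level of the Sylow transfer, VIII: the Galois octic core of a Galois CM field of degree `8m`, `3 ∤ m`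

**`exists_galois_octic_subfield`**: a Galois CM field `F` of degree `8m` (`m` odd, `3 ∤ m`) contains an intermediate field `E` of degree `8` with
`Gal(F/E) ⊴ Gal(F/ℚ)` of order `m` — i.e. `E/ℚ` is Galois (and CM: complex conjugation, of order `2`, acts non-trivially on `E`) and `F/E` is Galois of odd
degree `m`.  This is part XVIII (`SylowTransfer.exists_normal_card_eq_of_card_eq_eight_mul`: a normal subgroup of order `m`, by Burnside transfer twice)
read through the Galois correspondence, with complex conjugation as the central involution.  CENSUS READING: for `3 ∤ m` the degree-`8m` census is the
census of odd normal extensions of Galois OCTIC CM fields; when `Gal(F/E)` is cyclic and central (e.g. `F = E·L`, part VII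
`FaceSylowTransfer.isLeast_card_faces_hgen_of_galois_octic_compositum`) or reflected, `F` has EXACTLY `φ₂(F)` generating faces; the open rows are the
non-cyclic and the mixed odd parts.  `HC_CM` is NOT proved.

## References
* [Pohlmann1968] H. Pohlmann, Algebraic cycles on abelian varieties of complex multiplication type, Ann. of Math. 88 (1968), Thm 1.
* [Shimura1998] G. Shimura, Abelian Varieties with Complex Multiplication and Modular Functions, §6.2 Thm. 3, §8.1.
-/

noncomputable section

open CategoryTheory NumberField NumberField.ComplexEmbedding
open Literature.AlgebraicGeometry Literature.AlgebraicGeometry.Motives Literature.AlgebraicGeometry.HodgeTheory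
open Literature.AlgebraicGeometry.ComplexMultiplication Literature.AlgebraicGeometry.Milne1999
open Literature.NumberTheory.Automorphic
open Literature.NumberTheory.Automorphic.PicardCM
open Summit.HodgeConjecture.CorCM.Domination

namespace Summit.HodgeConjecture.CorCM.FaceSylowTransfer

open Summit.HodgeConjecture.CorCM.Prior.AllgGroup.RfwfAllgGroup
open Summit.HodgeConjecture.CorCM.Census.BlockParity
open Summit.HodgeConjecture.CorCM.Census.Coinvariant
open Summit.HodgeConjecture.CorCM.Census

section Field

variable {F : Type} [Field F] [NumberField F]

/-- **THE GALOIS OCTIC CORE.**  `F` Galois CM of degree `8m`, `m` odd, `3 ∤ m` ⟹ there is an intermediate field `E` with `[E:ℚ] = 8`,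
`Gal(F/E) ⊴ Gal(F/ℚ)` (so `E/ℚ` is Galois) and `|Gal(F/E)| = m`. [folklore] -/
theorem exists_galois_octic_subfield [IsCMField F] [IsGalois ℚ F] (σ₀ : F →+* ℂ) {m : ℕ} (hm : Odd m) (h3 : ¬ 3 ∣ m)
    (hdeg : Module.finrank ℚ F = 8 * m) :
    ∃ E : IntermediateField ℚ F, Module.finrank ℚ E = 8 ∧ E.fixingSubgroup.Normal ∧ Nat.card E.fixingSubgroup = m := by
  obtain ⟨c, hc⟩ := FaceCensus.exists_conjAut (F := F) σ₀
  have hG : Nat.card (F ≃ₐ[ℚ] F) = 8 * m := by rw [IsGalois.card_aut_eq_finrank, hdeg]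
  obtain ⟨M, hMn, hMcard⟩ := SylowTransfer.exists_normal_card_eq_of_card_eq_eight_mul c hm h3 hG
    (FaceCensus.conjAut_mul_self σ₀ hc) (FaceCensus.conjAut_ne_one σ₀ hc) (FaceCensus.conjAut_comm σ₀ hc)
  refine ⟨IntermediateField.fixedField M, ?_, ?_, ?_⟩
  · have h1 := Module.finrank_mul_finrank ℚ (IntermediateField.fixedField M) F
    rw [IntermediateField.finrank_fixedField_eq_card, hMcard, hdeg] at h1
    exact Nat.eq_of_mul_eq_mul_right hm.pos h1
  · rw [IntermediateField.fixingSubgroup_fixedField]; exact hMn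
  · rw [IntermediateField.fixingSubgroup_fixedField]; exact hMcard

/-- **… and complex conjugation is NOT in `Gal(F/E)`** (its order `2` does not divide `m`): the octic core `E` is not fixed by complex conjugation, so it is a
(Galois, hence) CM field rather than a totally real one. [folklore] -/
theorem conjAut_notMem_of_card_odd [IsCMField F] [IsGalois ℚ F] (σ₀ : F →+* ℂ) {c : F ≃ₐ[ℚ] F} (hc : σ₀.comp (c : F →+* F) = conjugate σ₀)
    (M : Subgroup (F ≃ₐ[ℚ] F)) {m : ℕ} (hm : Odd m) (hMcard : Nat.card M = m) : c ∉ M := by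
  intro hcM
  have h2 : orderOf c = 2 := orderOf_eq_prime (by rw [pow_two, FaceCensus.conjAut_mul_self σ₀ hc]) (FaceCensus.conjAut_ne_one σ₀ hc)
  have hdvd : 2 ∣ m := by rw [← h2, ← hMcard]; exact Subgroup.orderOf_dvd_natCard M hcM
  exact Nat.not_even_iff_odd.mpr hm (even_iff_two_dvd.mpr hdvd)

/-- **AN AUTOMORPHISM OF ORDER `m` GENERATES A NORMAL SUBGROUP** (`[F:ℚ] = 8m`, `m` odd, `3 ∤ m`): every conjugate of `z₀` is a power of `z₀` — the
Galois-theoretic input of gen 53ʼs `…_of_galois_subfield_eight` without assuming the fixed field of `⟨z₀⟩` Galois. [folklore] -/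
theorem conj_mem_zpowers_of_finrank_eq_eight_mul [IsCMField F] [IsGalois ℚ F] (σ₀ : F →+* ℂ) {m : ℕ} (hm : Odd m) (h3 : ¬ 3 ∣ m)
    (hdeg : Module.finrank ℚ F = 8 * m) (z₀ : F ≃ₐ[ℚ] F) (hz : orderOf z₀ = m) (w : F ≃ₐ[ℚ] F) :
    w * z₀ * w⁻¹ ∈ Subgroup.zpowers z₀ := by
  obtain ⟨c, hc⟩ := FaceCensus.exists_conjAut (F := F) σ₀
  have hG : Nat.card (F ≃ₐ[ℚ] F) = 8 * m := by rw [IsGalois.card_aut_eq_finrank, hdeg]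
  exact SylowTransfer.conj_mem_zpowers_of_card_eq_eight_mul c hm h3 hG (FaceCensus.conjAut_mul_self σ₀ hc)
    (FaceCensus.conjAut_ne_one σ₀ hc) (FaceCensus.conjAut_comm σ₀ hc) z₀ hz w

end Field

end Summit.HodgeConjecture.CorCM.FaceSylowTransfer
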